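/-
Copyright (c) 2026. All rights reserved.
Released under Apache 2.0 license as described in the file LICENSE.
Authors: abc-iut cell, seat abc-iut-f-069 (gen 3; row «P13-IL-OFOUTERACTION»).
-/
import Literature.AnabelianGeometry.AbsoluteAnabelian.AbsTopII.DPSCIndexDataOfOuterActionProp13v
import Literature.AnabelianGeometry.AbsoluteAnabelian.AbsTopII.DPSCDataOfOuterActionEdges

/-!
# [AbsTopII] Prop 1.3 (v) at `Π_𝒢 ⋊^out_θ J`: the input "(iv) at open subgroups" from a NON-DEGENERATE
# Dehn-type inertia action

S. Mochizuki, *Topics in Absolute Anabelian Geometry II* [AbsTopII] (bib `MochizukiAbsTopII2013`; kurims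
manuscript `paper:url-585b8d0ad0d9`), §1 Def 1.2 (ii) p. 10, Prop 1.3 (iv), (v) pp. 11–12, proof of (v)
p. 16: "it follows from assertion (iv) [i.e., by applying assertion (iv) to various open subgroups of
`Π_H`, `Π_I` — cf. also Remark 1.2.1] that if, for `γ ∈ Π_H`, `I_v ∩ (γ·I_v·γ⁻¹) ≠ {1}`, then
`Π_v = γ·Π_v·γ⁻¹`" — row P13/I-L of the cell's sub-DAG `plan/L4/SUBDAG-AbsTopII-Prop13.md`, a HYPOTHESIS
(`hL`) of every (v)-closer so far (abc-iut-L4-t6 p425615, abc-iut-w5-d226 `prop13v_ofOuterAction`,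
abc-iut-f-069 `prop_1_3_v'_ofOuterAction_of_dehn` p443920; abc-iut-f-066's `inputL_of_coverings` reduces
it, for ABSTRACT data, to (iv)′.2 at the finite étale coverings).

PROOF-ONLY (no definition).  At the CONSTRUCTED DPSC-extension `Π_𝒢 ⋊^out_θ J` (abc-iut-w5-d226's
`DPSCData.ofOuterAction`) row I-L is DISCHARGED from a hypothesis on the construction data, the θ-language
form of (iv)′.2 "`I_v ∩ I_{v′} ≠ {1}` implies `v = v′`": **`ρ_I` is a NON-DEGENERATE profinite Dehn
multi-twist** — for `i ∈ I`, `i ≠ 1`, a bi-continuous lift of `θ(i)` fixing pointwise both `Π_v` and a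
conjugate verticial subgroup `γΠ_{v′}γ⁻¹` forces `γΠ_{v′}γ⁻¹ = Π_v` (a non-trivial inertia element twists
non-trivially across every node, so its Dehn-type lift fixes at most ONE pro-vertex group).  Mechanism
(`inputL_ofOuterAction_of_nondegenerate`): for `1 ≠ h ∈ I_v ∩ gI_vg⁻¹`, `h ∉ Π_𝔾` (`I_v ∩ Π_𝔾 = {1}`), so
`snd h ≠ 1`; the `Aut`-component `conjAutOf h` is a lift of `θ(snd h)` fixing `Π_v` pointwise (`h`
centralises `inl Π_v`, `inl` injective as `Π_𝒢` is centre-free) and fixing `conjAutOf g (Π_v)` pointwise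
(`g⁻¹hg` centralises `inl Π_v`), and `conjAutOf g (Π_v) = γΠ_{v′}γ⁻¹` by GRAPHICITY of `conjAutOf g`
([CombGC] Def 1.4 (i)); non-degeneracy gives `γΠ_{v′}γ⁻¹ = Π_v`, i.e. `gΠ_vg⁻¹ = Π_v` in `Π_H`.
Consequences: `prop13v_ofOuterAction_of_nondegenerate` (F-0278) and
`prop_1_3_v'_ofOuterAction_of_nondegenerate` (F-0300) at `Π_𝒢 ⋊^out_θ J` from hypotheses on
(G, J, θ, I) ONLY — graphic lifts of `θ`, F-0438, F-0459, Rmk 1.1.3 slimness, Π_v-fixing lifts of `ρ_I`,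
non-degeneracy, `I` closed with `I ≅ Ẑ^Σ`.
HONEST FRAMING: classical group theory; the named inputs stay hypotheses (typed ≠ proved); nothing here
bears on [IUTchIII] Cor 3.12 or takes a side on any author.
-/

noncomputable section

open scoped Pointwise

namespace Literature.AnabelianGeometry.AbsoluteAnabelian

open Literature.AlgebraicGeometry.Frobenioids (IsSlimGroup)
open Literature.AnabelianGeometry.EtaleTheta (contMulAut mem_contMulAut TopOut innerContAut innerAut)
open Literature.AnabelianGeometry.SemiGraphs
open Literature.AnabelianGeometry.Anabelioids (IsSigmaInteger)
open Topology

universe u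

/-! ## §A. Generic transport -/

section GroupTheory

variable {G : Type u} [Group G]

/-- `g·Z_G(K)·g⁻¹ = Z_G(g·K·g⁻¹)` (twin of the private transport lemmas of the AbsTopII files). [folklore] -/
private theorem conj_smul_centralizer'' (g : G) (K : Subgroup G) :
    MulAut.conj g • Subgroup.centralizer (K : Set G) =
      Subgroup.centralizer ((MulAut.conj g • K : Subgroup G) : Set G) := by
  ext x
  rw [Subgroup.mem_pointwise_smul_iff_inv_smul_mem, Subgroup.mem_centralizer_iff,
    Subgroup.mem_centralizer_iff]
  constructor
  · intro h m hm
    rw [SetLike.mem_coe, Subgroup.mem_pointwise_smul_iff_inv_smul_mem] at hm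
    have e := h _ hm
    rw [← smul_mul', ← smul_mul'] at e
    exact MulAction.injective _ e
  · intro h k hk
    have e := h (MulAut.conj g • k) (Subgroup.smul_mem_pointwise_smul _ _ _ hk)
    apply MulAction.injective (MulAut.conj g)
    simp only [smul_mul', smul_inv_smul]
    exact e

end GroupTheory

namespace DPSCData

section OuterAction

variable {P : Type u} [Group P] [TopologicalSpace P] [IsTopologicalGroup P] [CompactSpace P]
  [TotallyDisconnectedSpace P] (G : PSCDatum P) (hG : IsTopologicallyFinitelyGenerated P)
  (hZ : Subgroup.center P = ⊥)
  {J : Type u} [Group J] [TopologicalSpace J] [IsTopologicalGroup J] [CompactSpace J]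
  [TotallyDisconnectedSpace J] (θ : J →ₜ* outProfinite hG) (I : Subgroup J) [I.Normal]

omit [I.Normal] in
/-- **Conjugating `inl(K)` by `g ∈ Π_𝒢 ⋊^out J` is `inl` of the image of `K` under the `Aut`-component of
`g`** (`h · inl x · h⁻¹ = inl (conjAutOf h x)`). [cite: MochizukiSemiAnbd2006, §0 p.5] -/
theorem conj_smul_map_inl_eq (g : outerSemidirectProfinite hG θ) (K : Subgroup P) :
    MulAut.conj g • (K.map (inlProfinite hG θ).toMonoidHom : Subgroup (outerSemidirectProfinite hG θ)) =
      (K.map (conjAutOf hG θ g).toMulEquiv.toMonoidHom).map (inlProfinite hG θ).toMonoidHom := by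
  apply le_antisymm
  · rintro _ ⟨_, ⟨x, hx, rfl⟩, rfl⟩
    refine ⟨conjAutOf hG θ g x, ⟨x, hx, rfl⟩, ?_⟩
    show inlProfinite hG θ (conjAutOf hG θ g x) = MulAut.conj g • inlProfinite hG θ x
    rw [inlProfinite_conjAutOf, MulAut.smul_def, MulAut.conj_apply]
  · rintro _ ⟨_, ⟨x, hx, rfl⟩, rfl⟩
    refine ⟨inlProfinite hG θ x, ⟨x, hx, rfl⟩, ?_⟩
    show MulAut.conj g • inlProfinite hG θ x = inlProfinite hG θ (conjAutOf hG θ g x)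
    rw [inlProfinite_conjAutOf, MulAut.smul_def, MulAut.conj_apply]

omit [I.Normal] in
include hZ in
/-- **An element centralising `inl(K)` has `Aut`-component fixing `K` pointwise** (`inl` is injective,
`Π_𝒢` being centre-free). [cite: MochizukiSemiAnbd2006, §0 p.5] -/
theorem conjAutOf_apply_eq_self_of_mem_centralizer {K : Subgroup P} {h : outerSemidirectProfinite hG θ}
    (hh : h ∈ Subgroup.centralizer ((K.map (inlProfinite hG θ).toMonoidHom :
      Subgroup (outerSemidirectProfinite hG θ)) : Set (outerSemidirectProfinite hG θ))) :
    ∀ x ∈ K, conjAutOf hG θ h x = x := by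
  intro x hx
  apply inlProfinite_injective hG θ hZ
  rw [inlProfinite_conjAutOf]
  have e := (Subgroup.mem_centralizer_iff.mp hh) _ ⟨x, hx, rfl⟩
  change inlProfinite hG θ x * h = h * inlProfinite hG θ x at e
  rw [← e, mul_inv_cancel_right]

include hZ in
/-- **Row I-L ("(iv) at open subgroups") DISCHARGED at `Π_𝒢 ⋊^out_θ J` from a NON-DEGENERATE Dehn-type
inertia action.**  Hypotheses: graphicity of the `Aut`-components (Def 1.2 (ii) "`Aut(𝒢) ⊆ Out(Π_𝒢)`"),
`I_v ∩ Π_𝔾 = {1}` (first clause of (iii): slimness + [CombGC] Prop 1.2 (ii)), and NON-DEGENERACY: for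
`i ∈ I`, `i ≠ 1`, a bi-continuous lift of `θ(i)` fixing pointwise `Π_v` and a conjugate verticial subgroup
`γΠ_{v′}γ⁻¹` forces `γΠ_{v′}γ⁻¹ = Π_v` (the θ-form of (iv)′.2).  Conclusion: VERBATIM the hypothesis `hL` of
the (v)-closers — "if `I_v ∩ (g·I_v·g⁻¹) ≠ {1}`, then `Π_v = g·Π_v·g⁻¹`" (proof of (v) p. 16).
[cite: MochizukiAbsTopII2013, Prop 1.3 (v) proof p.16] [cite: MochizukiCombGC2007, Def 1.4(i) p.10] -/
theorem inputL_ofOuterAction_of_nondegenerate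
    (hgraphic : ∀ h : outerSemidirectProfinite hG θ, G.IsGraphic G (conjAutOf hG θ h))
    (h13 : ∀ v, (ofOuterAction G hG θ I).Iv v ⊓ (ofOuterAction G hG θ I).PiG = ⊥)
    (hND : ∀ i ∈ I, i ≠ 1 → ∀ (v v' : G.graph.V) (γ : ConjAct P),
      (∃ φ : P ≃ₜ* P,
        TopOut.mk P ⟨φ.toMulEquiv, (mem_contMulAut P).mpr ⟨φ.continuous, φ.symm.continuous⟩⟩ =
          outerActionOfContinuous hG θ i ∧ (∀ x ∈ G.vertGp v, φ x = x) ∧ ∀ x ∈ γ • G.vertGp v', φ x = x) →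
      γ • G.vertGp v' = G.vertGp v) :
    ∀ (v : (ofOuterAction G hG θ I).Vert) (g : (ofOuterAction G hG θ I).PiH),
      (ofOuterAction G hG θ I).Iv v ⊓ MulAut.conj g • (ofOuterAction G hG θ I).Iv v ≠ ⊥ →
        MulAut.conj g • (ofOuterAction G hG θ I).vertSub v = (ofOuterAction G hG θ I).vertSub v := by
  intro v g hne
  -- a non-trivial element of `I_v ∩ gI_vg⁻¹`
  obtain ⟨h, hh, hne1⟩ := ((ofOuterAction G hG θ I).Iv v ⊓
    MulAut.conj g • (ofOuterAction G hG θ I).Iv v).bot_or_exists_ne_one.resolve_left hne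
  obtain ⟨hIv, hgIv⟩ := Subgroup.mem_inf.mp hh
  -- graphicity of `conjAutOf g`: `conjAutOf g (Π_v) = γΠ_{v′}γ⁻¹`
  obtain ⟨ι, hV, -, -⟩ := hgraphic g
  obtain ⟨γ, hγ⟩ := hV v.down
  have hconjV : MulAut.conj g • (ofOuterAction G hG θ I).vertSub v =
      ((γ • G.vertGp (ι.vertEquiv v.down)).map (inlProfinite hG θ).toMonoidHom :
        Subgroup (ofOuterAction G hG θ I).PiH) := by
    have e1 := conj_smul_map_inl_eq hG θ g (G.vertGp v.down)
    rw [hγ] at e1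
    exact e1
  -- `h ∉ Π_𝔾`: otherwise `h ∈ I_v ∩ Π_𝔾 = {1}`
  have hi : sndProfinite hG θ h ≠ 1 := by
    intro h1
    have hG' : h ∈ (ofOuterAction G hG θ I).PiG := by
      show h ∈ (inlProfinite hG θ).toMonoidHom.range
      rw [range_inlProfinite_eq_ker]
      exact h1
    have hbot : h ∈ (ofOuterAction G hG θ I).Iv v ⊓ (ofOuterAction G hG θ I).PiG := ⟨hIv, hG'⟩
    rw [h13 v, Subgroup.mem_bot] at hbot
    exact hne1 hbot
  have hiI : sndProfinite hG θ h ∈ I := (Subgroup.mem_inf.mp hIv).2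
  -- `conjAutOf h` fixes `Π_v` pointwise
  have hfix₁ : ∀ x ∈ G.vertGp v.down, conjAutOf hG θ h x = x :=
    conjAutOf_apply_eq_self_of_mem_centralizer hG hZ θ (Subgroup.mem_inf.mp hIv).1
  -- `conjAutOf h` fixes `γΠ_{v′}γ⁻¹ = conjAutOf g (Π_v)` pointwise: `g⁻¹hg` centralises `inl Π_v`
  have hfix₂ : ∀ x ∈ γ • G.vertGp (ι.vertEquiv v.down), conjAutOf hG θ h x = x := by
    apply conjAutOf_apply_eq_self_of_mem_centralizer hG hZ θ
    have hmem : h ∈ MulAut.conj g •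
        Subgroup.centralizer (((ofOuterAction G hG θ I).vertSub v : Subgroup (ofOuterAction G hG θ I).PiH) :
          Set (ofOuterAction G hG θ I).PiH) := by
      rw [Subgroup.mem_pointwise_smul_iff_inv_smul_mem] at hgIv ⊢
      exact (Subgroup.mem_inf.mp hgIv).1
    rw [conj_smul_centralizer'', hconjV] at hmem
    exact hmem
  -- `conjAutOf h` is a lift of `θ (snd h)`
  have hclass : TopOut.mk P ⟨(conjAutOf hG θ h).toMulEquiv, (mem_contMulAut P).mpr
      ⟨(conjAutOf hG θ h).continuous, (conjAutOf hG θ h).symm.continuous⟩⟩ =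
        outerActionOfContinuous hG θ (sndProfinite hG θ h) := by
    have : (⟨(conjAutOf hG θ h).toMulEquiv, (mem_contMulAut P).mpr
        ⟨(conjAutOf hG θ h).continuous, (conjAutOf hG θ h).symm.continuous⟩⟩ : contMulAut P) =
          autComponent hG θ h := Subtype.ext rfl
    rw [this, mk_autComponent]
    rfl
  -- non-degeneracy
  have hγv : γ • G.vertGp (ι.vertEquiv v.down) = G.vertGp v.down :=
    hND _ hiI hi v.down (ι.vertEquiv v.down) γ ⟨conjAutOf hG θ h, hclass, hfix₁, hfix₂⟩
  rw [hconjV, hγv]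
  rfl

include hZ in
/-- **[AbsTopII] Prop 1.3 (v), outer clauses AS TYPED (F-0278) at `Π_𝒢 ⋊^out_θ J` from hypotheses on the
CONSTRUCTION DATA ONLY** — graphic lifts of `θ`, [CombGC] Prop 1.2 (ii)/(i) for `G`, slim verticial
subgroups, Π_v-fixing lifts of `ρ_I` (Dehn type), NON-DEGENERACY of `ρ_I`, `I` closed with `I ≅ Ẑ^Σ` —
`prop13v_ofOuterAction_of_dehn` (p443920) with row I-L DISCHARGED by `inputL_ofOuterAction_of_nondegenerate`.
[cite: MochizukiAbsTopII2013, Prop 1.3 (v) p.12] [cite: MochizukiCombGC2007, Prop 1.2 p.8] -/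
theorem prop13v_ofOuterAction_of_nondegenerate
    (hθ : ∀ j : J, ∃ φ : P ≃ₜ* P,
      TopOut.mk P ⟨φ.toMulEquiv, (mem_contMulAut P).mpr ⟨φ.continuous, φ.symm.continuous⟩⟩ =
        outerActionOfContinuous hG θ j ∧ G.IsGraphic G φ)
    (hCT : G.VerticialEdgeLikeCommensurablyTerminal) (hDetV : G.VerticialOpenInterDeterminesVertex)
    (hslimv : ∀ w, IsSlimGroup ↥(G.vertGp w))
    (hDehn : ∀ (v : G.graph.V) (i : J), i ∈ I → ∃ φ : P ≃ₜ* P,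
      TopOut.mk P ⟨φ.toMulEquiv, (mem_contMulAut P).mpr ⟨φ.continuous, φ.symm.continuous⟩⟩ =
        outerActionOfContinuous hG θ i ∧ ∀ x ∈ G.vertGp v, φ x = x)
    (hND : ∀ i ∈ I, i ≠ 1 → ∀ (v v' : G.graph.V) (γ : ConjAct P),
      (∃ φ : P ≃ₜ* P,
        TopOut.mk P ⟨φ.toMulEquiv, (mem_contMulAut P).mpr ⟨φ.continuous, φ.symm.continuous⟩⟩ =
          outerActionOfContinuous hG θ i ∧ (∀ x ∈ G.vertGp v, φ x = x) ∧ ∀ x ∈ γ • G.vertGp v', φ x = x) →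
      γ • G.vertGp v' = G.vertGp v)
    (hIc : IsClosed (I : Set J)) (hI : AbsTopII.IsFreeProSigmaCyclic G.Sigma ↥I) :
    (ofOuterAction G hG θ I).Prop13v :=
  AbsTopII.DPSCIndexData.prop13v_ofOuterAction_of_dehn G hG hZ θ I
    (isGraphic_conjAutOf_of_lifts G hG θ hθ) hCT hDetV hslimv hDehn hIc hI
    (inputL_ofOuterAction_of_nondegenerate G hG hZ θ I (isGraphic_conjAutOf_of_lifts G hG θ hθ)
      (fun v => (prop13iii_ofOuterAction_of_fixing_lifts G hG hZ θ I hCT hslimv hDehn v).1) hND)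

omit [IsTopologicalGroup J] [CompactSpace J] [TotallyDisconnectedSpace J] [I.Normal] in
/-- **Non-degeneracy is automatic in the SMOOTH case** (one vertex, `Π_v = Π_𝒢`: every conjugate verticial
subgroup IS `Π_𝒢`), so at such data the (v)-closers below need only the Dehn-type lifts — e.g. the
`ℤ_l`-inertia model of `DPSCIndexData.exists_ofOuterAction_prop_1_3_iii'`.
[cite: MochizukiAbsTopII2013, Prop 1.3 (iii) proof p.13] -/
theorem nondegenerate_of_vertGp_eq_top (hsm : ∀ v, G.vertGp v = ⊤) :
    ∀ i ∈ I, i ≠ 1 → ∀ (v v' : G.graph.V) (γ : ConjAct P),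
      (∃ φ : P ≃ₜ* P,
        TopOut.mk P ⟨φ.toMulEquiv, (mem_contMulAut P).mpr ⟨φ.continuous, φ.symm.continuous⟩⟩ =
          outerActionOfContinuous hG θ i ∧ (∀ x ∈ G.vertGp v, φ x = x) ∧ ∀ x ∈ γ • G.vertGp v', φ x = x) →
      γ • G.vertGp v' = G.vertGp v := by
  intro i _ _ v v' γ _
  rw [hsm v, hsm v']
  exact top_le_iff.mp fun x _ =>
    Subgroup.mem_pointwise_smul_iff_inv_smul_mem.mpr (Subgroup.mem_top _)

end OuterAction

end DPSCData

namespace AbsTopII.DPSCIndexData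

section OuterAction

variable {P : Type u} [Group P] [TopologicalSpace P] [IsTopologicalGroup P] [CompactSpace P]
  [TotallyDisconnectedSpace P] (G : PSCDatum P) (hG : IsTopologicallyFinitelyGenerated P)
  (hZ : Subgroup.center P = ⊥)
  {J : Type u} [Group J] [TopologicalSpace J] [IsTopologicalGroup J] [CompactSpace J]
  [TotallyDisconnectedSpace J] (θ : J →ₜ* outProfinite hG) (I : Subgroup J) [I.Normal]
  (σ : G.graph.N → ℕ) (hσ : ∀ e, IsSigmaInteger G.Sigma (σ e))

include hZ

/-- **[AbsTopII] Prop 1.3 (v), middle clause AS TYPED (F-0300, `Prop_1_3_v'`) at `Π_𝒢 ⋊^out_θ J` from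
hypotheses on the CONSTRUCTION DATA ONLY** (as `DPSCData.prop13v_ofOuterAction_of_nondegenerate`): the
(v)/(v′) column of the cell's Prop 1.3 sub-DAG has no `Π_I`-level residue left at constructed data.
[cite: MochizukiAbsTopII2013, Prop 1.3 (v) p.12] [cite: MochizukiCombGC2007, Prop 1.2 p.8] -/
theorem prop_1_3_v'_ofOuterAction_of_nondegenerate
    (hθ : ∀ j : J, ∃ φ : P ≃ₜ* P,
      TopOut.mk P ⟨φ.toMulEquiv, (mem_contMulAut P).mpr ⟨φ.continuous, φ.symm.continuous⟩⟩ =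
        outerActionOfContinuous hG θ j ∧ G.IsGraphic G φ)
    (hCT : G.VerticialEdgeLikeCommensurablyTerminal) (hDetV : G.VerticialOpenInterDeterminesVertex)
    (hslimv : ∀ w, IsSlimGroup ↥(G.vertGp w))
    (hDehn : ∀ (v : G.graph.V) (i : J), i ∈ I → ∃ φ : P ≃ₜ* P,
      TopOut.mk P ⟨φ.toMulEquiv, (mem_contMulAut P).mpr ⟨φ.continuous, φ.symm.continuous⟩⟩ =
        outerActionOfContinuous hG θ i ∧ ∀ x ∈ G.vertGp v, φ x = x)
    (hND : ∀ i ∈ I, i ≠ 1 → ∀ (v v' : G.graph.V) (γ : ConjAct P),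
      (∃ φ : P ≃ₜ* P,
        TopOut.mk P ⟨φ.toMulEquiv, (mem_contMulAut P).mpr ⟨φ.continuous, φ.symm.continuous⟩⟩ =
          outerActionOfContinuous hG θ i ∧ (∀ x ∈ G.vertGp v, φ x = x) ∧ ∀ x ∈ γ • G.vertGp v', φ x = x) →
      γ • G.vertGp v' = G.vertGp v)
    (hIc : IsClosed (I : Set J)) (hI : IsFreeProSigmaCyclic G.Sigma ↥I) :
    Literature.AnabelianGeometry.AbsoluteAnabelian.AbsTopII.DPSCIndexData.Prop_1_3_v'
      (ofOuterAction G hG θ I σ hσ) :=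
  prop_1_3_v'_ofOuterAction_of_dehn G hG hZ θ I σ hσ (DPSCData.isGraphic_conjAutOf_of_lifts G hG θ hθ)
    hCT hDetV hslimv hDehn hIc hI
    (DPSCData.inputL_ofOuterAction_of_nondegenerate G hG hZ θ I
      (DPSCData.isGraphic_conjAutOf_of_lifts G hG θ hθ)
      (fun v => (DPSCData.prop13iii_ofOuterAction_of_fixing_lifts G hG hZ θ I hCT hslimv hDehn v).1) hND)

end OuterAction

end AbsTopII.DPSCIndexData

end Literature.AnabelianGeometry.AbsoluteAnabelian

end
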